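import Summits.CriticalPhenomena.CardyFormulaZ2.Theorems.LagHandOff.Negative.ArcSwap
import HarnessLib

/-!
# `LagHandOff` (stmt-CriticalPhenomena-10268), line `crosscut-dictionary` (cycle-2 reshape): the
# wiring-swap ("ArcSwap") obligation — part 2, where it sits among the RESHAPED registered stubs

Refuter `drefute` (g2).  Continuation of `Negative/ArcSwap.lean` (def-free orientation-reversed
twin; `wiringSwap_sameLimit_of_map_eq / _of_isLocal / _of_isDomainMarkov`).  The lead's cycle-2
reshape of the skeleton (`Cruxes/LagHandOff/Lines/crosscut-dictionary.lean`, 2026-08-16) moved the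
obligation found by drefute g1/g2 into two registered stubs; this file records, as theorems about
their REGISTERED STATEMENTS (taken verbatim as hypotheses), how they relate:

* `map_eq_map_of_slitExtension`, `carrierDetermines_of_slitExtension` — the field `hext` of the
  ENLARGED `stub_crosscutDictionary` (a slit explorer `Φ (U; x, b)` indexed by the bare carrier and
  the two marked points, with `(Φ (D.carrier; a, b))_* μ = (Ψ D)_* μ` for every Dobrushin
  structure `D` and every `μ ∈ Λ`) implies IN THREE LINES the whole conclusion of the registered
  stub `stub_carrierDetermines` (`(Ψ D')_* μ = (Ψ D)_* μ` whenever `(carrier, a, b)` agree) for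
  the dictionary's own reading `Ψ` — which is the only reading the composition `LagHandOff_of`
  feeds to it.  `carrierDetermines_of_stub_crosscutDictionary`: the registered statement of the
  enlarged dictionary stub ALREADY produces a reading with the carrier-determines property.  So,
  inside this skeleton, `stub_carrierDetermines` (rated L/XL, with two registered sub-goals
  `…_arcDichotomy`, `…_coOriented`) is REDUNDANT: feed `hext` (then it is this lemma) or delete it.
* `wiringSwap_sameLimit_of_stub_carrierDetermines` — conversely, what the registered statement of
  `stub_carrierDetermines` asserts about bond-`ℤ²`, for ANY reading with the hands-off field: the
  `(ab)`-wired and the `(ba)`-wired interface statistics of every admissible family of every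
  Dobrushin domain have the same limit along every quad-convergent mesh sequence — the ArcSwap
  universality (self-duality lands on the half-mesh translate of the domain), which its listed
  hypotheses (measurability, `δℤ²`-only hands-off, discretisability) do not supply (the lead's own
  docstring: "L with R2, XL without"; R2 = hands-off at lattice offsets).  As a standalone stub it
  is therefore the universality statement itself; `wiringSwap_sameLimit_of_slitExtension` shows
  the enlarged dictionary's `hext` carries the same lattice content — that is where it is paid.

No statement of the route is asserted; nothing is refuted; both registered statements are believed
true (consistent with an SLE₆ limit).

References: W. Werner, Lectures on two-dimensional critical percolation (2007) §3.2;
S. Smirnov, ICM 2006 §2.1 (bond-`ℤ²` exploration, self-duality).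
-/

noncomputable section

open MeasureTheory Filter Set Topology
open scoped BoundedContinuousFunction
open Literature.Probability.Percolation Literature.Probability.LatticeModels
open Literature.Probability.RandomPlanarGeometry Literature.Probability.Percolation.QuadCrossing
open Summit.CriticalPhenomena.CardyFormulaZ2.Theses.CardySelfRefinement

namespace Summit.CriticalPhenomena.CardyFormulaZ2.Theorems.LagHandOff.Negative

/-! ### The slit-extension field `hext` of the enlarged dictionary contains carrier-dependence -/

/-- **`hext` encodes wiring blindness.** If a slit reading `Φ (U; x, b)`, indexed by the bare set
and the two points, reproduces the law of `Ψ D` on `(D.carrier; a, b)` for every Dobrushin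
structure `D`, then two Dobrushin structures with the same `(carrier, a, b)` — in particular a
domain and its orientation-reversed twin — decode to the same law. [folklore] -/
theorem map_eq_map_of_slitExtension
    (Ψ : DobrushinDomain → QuadConfig (Set.univ : Set ℂ) → CurveClass ℂ)
    (Φ : Set ℂ → ℂ → ℂ → QuadConfig (Set.univ : Set ℂ) → CurveClass ℂ)
    (μ : Measure (QuadConfig (Set.univ : Set ℂ)))
    (hext : ∀ D : DobrushinDomain, μ.map (Φ D.carrier (D.pt 0) (D.pt 1)) = μ.map (Ψ D))
    {D D' : DobrushinDomain} (hc : D'.carrier = D.carrier) (h0 : D'.pt 0 = D.pt 0)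
    (h1 : D'.pt 1 = D.pt 1) : μ.map (Ψ D') = μ.map (Ψ D) := by
  rw [← hext D', ← hext D, hc, h0, h1]

/-- **The conclusion of the registered stub `stub_carrierDetermines`, in three lines from `hext`.**
For the dictionary's reading `Ψ`, the `hext` field of the enlarged `stub_crosscutDictionary`
(quantified over `μ ∈ Λ`, verbatim) gives the carrier-dependence statement in exactly the form
consumed by `stub_localityPassage2` / `LagHandOff_of`. [folklore] -/
theorem carrierDetermines_of_slitExtension
    (Ψ : DobrushinDomain → QuadConfig (Set.univ : Set ℂ) → CurveClass ℂ)
    (Φ : Set ℂ → ℂ → ℂ → QuadConfig (Set.univ : Set ℂ) → CurveClass ℂ)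
    (hext : ∀ μ ∈ subseqQuadLimits (Set.univ : Set ℂ), ∀ D : DobrushinDomain,
      (μ : Measure (QuadConfig (Set.univ : Set ℂ))).map (Φ D.carrier (D.pt 0) (D.pt 1)) =
        (μ : Measure (QuadConfig (Set.univ : Set ℂ))).map (Ψ D)) :
    ∀ μ ∈ subseqQuadLimits (Set.univ : Set ℂ), ∀ D D' : DobrushinDomain,
      D'.carrier = D.carrier → D'.pt 0 = D.pt 0 → D'.pt 1 = D.pt 1 →
        (μ : Measure (QuadConfig (Set.univ : Set ℂ))).map (Ψ D') =
          (μ : Measure (QuadConfig (Set.univ : Set ℂ))).map (Ψ D) :=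
  fun μ hμ _ _ hc h0 h1 => map_eq_map_of_slitExtension Ψ Φ _ (hext μ hμ) hc h0 h1

/-- **The enlarged dictionary stub already yields a carrier-determined reading.** From the
registered statement of the ENLARGED `stub_crosscutDictionary` (cycle-2 skeleton; verbatim as
hypothesis `h2`): there is a reading `Ψ` with the measurability and hands-off fields AND the
conclusion of `stub_carrierDetermines` — so the composition needs no separate carrier stub.
[folklore] -/
theorem carrierDetermines_of_stub_crosscutDictionary
    (h2 : ∃ (Ψ : DobrushinDomain → QuadConfig (Set.univ : Set ℂ) → CurveClass ℂ)
        (Φ : Set ℂ → ℂ → ℂ → QuadConfig (Set.univ : Set ℂ) → CurveClass ℂ),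
      (∀ D : DobrushinDomain, Measurable (Ψ D)) ∧
      (∀ (D : DobrushinDomain) (c : ℂ) (hc : c ≠ 0) (w : ℂ) (S : QuadConfig (Set.univ : Set ℂ)),
        Ψ (D.map (similarity c hc w)) (S.mapHomeomorph (similarity c hc w)) =
          (Ψ D S).map (similarity c hc w : C(ℂ, ℂ))) ∧
      (∀ (μ : FiniteMeasure (QuadConfig (Set.univ : Set ℂ))) (δs : ℕ → ℝ), (∀ n, 0 < δs n) →
        Tendsto δs atTop (𝓝 0) →
        Tendsto (fun n => z2QuadLaw (Set.univ : Set ℂ) (δs n)) atTop (𝓝 μ) →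
        ∀ (D : DobrushinDomain) (E : ℝ → DiscreteDobrushin), ZdDiscretisationFamily D E →
          ∀ f : (QuadConfig (Set.univ : Set ℂ) × CurveClass ℂ) →ᵇ ℝ,
            Tendsto (fun n => ∫ ω, f (z2QuadConfig (Set.univ : Set ℂ) (δs n) ω,
                bondInterfaceIn D (E (δs n)) ω) ∂(bondPercolation (zdGraph 2) half))
              atTop (𝓝 (∫ S, f (S, Ψ D S) ∂(μ : Measure (QuadConfig (Set.univ : Set ℂ)))))) ∧
      ∀ μ ∈ subseqQuadLimits (Set.univ : Set ℂ),
        (∀ D : DobrushinDomain,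
          (μ : Measure (QuadConfig (Set.univ : Set ℂ))).map (Φ D.carrier (D.pt 0) (D.pt 1)) =
            (μ : Measure (QuadConfig (Set.univ : Set ℂ))).map (Ψ D)) ∧
        (∀ (D : DobrushinDomain) (T : Set (CurveClass ℂ)), MeasurableSet T →
          Measurable fun p : CurveClass ℂ =>
            (μ : Measure (QuadConfig (Set.univ : Set ℂ))).map
              (Φ (remainingDomain D p) p.target (D.pt 1)) T) ∧
        (∀ (D : DobrushinDomain) (F : Set ℂ), IsClosed F →
          ∀ S T : Set (CurveClass ℂ), MeasurableSet S → MeasurableSet T →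
            (μ : Measure (QuadConfig (Set.univ : Set ℂ)))
                ((Ψ D) ⁻¹' (CurveClass.stopAt F ⁻¹' S ∩ CurveClass.startFrom F ⁻¹' T)) =
              ∫⁻ ω in (Ψ D) ⁻¹' (CurveClass.stopAt F ⁻¹' S),
                (μ : Measure (QuadConfig (Set.univ : Set ℂ))).map
                  (Φ (remainingDomain D ((Ψ D ω).stopAt F)) ((Ψ D ω).stopAt F).target (D.pt 1)) T
                  ∂(μ : Measure (QuadConfig (Set.univ : Set ℂ))))) :
    ∃ Ψ : DobrushinDomain → QuadConfig (Set.univ : Set ℂ) → CurveClass ℂ,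
      (∀ D : DobrushinDomain, Measurable (Ψ D)) ∧
      (∀ (μ : FiniteMeasure (QuadConfig (Set.univ : Set ℂ))) (δs : ℕ → ℝ), (∀ n, 0 < δs n) →
        Tendsto δs atTop (𝓝 0) →
        Tendsto (fun n => z2QuadLaw (Set.univ : Set ℂ) (δs n)) atTop (𝓝 μ) →
        ∀ (D : DobrushinDomain) (E : ℝ → DiscreteDobrushin), ZdDiscretisationFamily D E →
          ∀ f : (QuadConfig (Set.univ : Set ℂ) × CurveClass ℂ) →ᵇ ℝ,
            Tendsto (fun n => ∫ ω, f (z2QuadConfig (Set.univ : Set ℂ) (δs n) ω,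
                bondInterfaceIn D (E (δs n)) ω) ∂(bondPercolation (zdGraph 2) half))
              atTop (𝓝 (∫ S, f (S, Ψ D S) ∂(μ : Measure (QuadConfig (Set.univ : Set ℂ)))))) ∧
      ∀ μ ∈ subseqQuadLimits (Set.univ : Set ℂ), ∀ D D' : DobrushinDomain,
        D'.carrier = D.carrier → D'.pt 0 = D.pt 0 → D'.pt 1 = D.pt 1 →
          (μ : Measure (QuadConfig (Set.univ : Set ℂ))).map (Ψ D') =
            (μ : Measure (QuadConfig (Set.univ : Set ℂ))).map (Ψ D) := by
  obtain ⟨Ψ, Φ, h1, -, h3, hslit⟩ := h2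
  exact ⟨Ψ, h1, h3, carrierDetermines_of_slitExtension Ψ Φ fun μ hμ => (hslit μ hμ).1⟩

/-- Hence, with the hands-off field, `hext` forces the wiring-swap universality on the lattice:
the `(ab)`-wired and `(ba)`-wired interface statistics of every admissible family of every
Dobrushin domain have the same limit along every quad-convergent mesh sequence — the lattice
content a construction of `Φ` with `hext` must pay for. [folklore] -/
theorem wiringSwap_sameLimit_of_slitExtension
    (Ψ : DobrushinDomain → QuadConfig (Set.univ : Set ℂ) → CurveClass ℂ)
    (hmeas : ∀ D : DobrushinDomain, Measurable (Ψ D))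
    (h3 : ∀ (μ : FiniteMeasure (QuadConfig (Set.univ : Set ℂ))) (δs : ℕ → ℝ), (∀ n, 0 < δs n) →
      Tendsto δs atTop (𝓝 0) →
      Tendsto (fun n => z2QuadLaw (Set.univ : Set ℂ) (δs n)) atTop (𝓝 μ) →
      ∀ (D : DobrushinDomain) (E : ℝ → DiscreteDobrushin), ZdDiscretisationFamily D E →
        ∀ f : (QuadConfig (Set.univ : Set ℂ) × CurveClass ℂ) →ᵇ ℝ,
          Tendsto (fun n => ∫ ω, f (z2QuadConfig (Set.univ : Set ℂ) (δs n) ω,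
              bondInterfaceIn D (E (δs n)) ω) ∂(bondPercolation (zdGraph 2) half))
            atTop (𝓝 (∫ S, f (S, Ψ D S) ∂(μ : Measure (QuadConfig (Set.univ : Set ℂ))))))
    (μ : FiniteMeasure (QuadConfig (Set.univ : Set ℂ))) (δs : ℕ → ℝ) (hpos : ∀ n, 0 < δs n)
    (hlim : Tendsto δs atTop (𝓝 0))
    (hquad : Tendsto (fun n => z2QuadLaw (Set.univ : Set ℂ) (δs n)) atTop (𝓝 μ))
    (Φ : Set ℂ → ℂ → ℂ → QuadConfig (Set.univ : Set ℂ) → CurveClass ℂ)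
    (hext : ∀ D : DobrushinDomain,
      (μ : Measure (QuadConfig (Set.univ : Set ℂ))).map (Φ D.carrier (D.pt 0) (D.pt 1)) =
        (μ : Measure (QuadConfig (Set.univ : Set ℂ))).map (Ψ D))
    (D : DobrushinDomain) (E : ℝ → DiscreteDobrushin) (hE : ZdDiscretisationFamily D E)
    (g : CurveClass ℂ →ᵇ ℝ) :
    Tendsto (fun n =>
        (∫ ω, g (bondInterfaceIn D (E (δs n)) ω) ∂(bondPercolation (zdGraph 2) half)) -
          ∫ ω, g (bondInterfaceIn D ⟨(E (δs n)).Ω, (E (δs n)).δ, (E (δs n)).arcB, (E (δs n)).arcA⟩ ω)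
            ∂(bondPercolation (zdGraph 2) half))
      atTop (𝓝 0) := by
  obtain ⟨D', hc, h0, h1, hA, hB⟩ := exists_orientationReversed D
  exact wiringSwap_sameLimit_of_map_eq Ψ hmeas h3 μ δs hpos hlim hquad hc h0 h1 hA hB
    (map_eq_map_of_slitExtension Ψ Φ _ hext hc h0 h1) E hE g

/-! ### What the registered `stub_carrierDetermines` asserts on the lattice -/

/-- **`stub_carrierDetermines` IS the wiring-swap universality.** The registered statement of
`stub_carrierDetermines` (cycle-2 skeleton; verbatim as hypothesis `hcar`), applied to ANY reading
`Ψ` with the measurability and `δℤ²` hands-off fields and to discretisability, gives, for every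
Dobrushin domain `D`, every `ℤ²`-discretisation family `E` of `D` and every quad-convergent
positive mesh sequence: the `(ab)`-wired and the `(ba)`-wired bond-`ℤ²` interface statistics
`∫ g (bondInterfaceIn D (E δₙ) ·) dPerc`, `∫ g (bondInterfaceIn D (E δₙ, arcs swapped) ·) dPerc`
have difference tending to `0`.  Its listed hypotheses export no offset-lattice or duality
information, so as a standalone stub it is this universality statement. [folklore] -/
theorem wiringSwap_sameLimit_of_stub_carrierDetermines
    (hcar : ∀ Ψ : DobrushinDomain → QuadConfig (Set.univ : Set ℂ) → CurveClass ℂ,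
      (∀ D : DobrushinDomain, Measurable (Ψ D)) →
      (∀ (μ : FiniteMeasure (QuadConfig (Set.univ : Set ℂ))) (δs : ℕ → ℝ), (∀ n, 0 < δs n) →
        Tendsto δs atTop (𝓝 0) →
        Tendsto (fun n => z2QuadLaw (Set.univ : Set ℂ) (δs n)) atTop (𝓝 μ) →
        ∀ (D : DobrushinDomain) (E : ℝ → DiscreteDobrushin), ZdDiscretisationFamily D E →
          ∀ f : (QuadConfig (Set.univ : Set ℂ) × CurveClass ℂ) →ᵇ ℝ,
            Tendsto (fun n => ∫ ω, f (z2QuadConfig (Set.univ : Set ℂ) (δs n) ω,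
                bondInterfaceIn D (E (δs n)) ω) ∂(bondPercolation (zdGraph 2) half))
              atTop (𝓝 (∫ S, f (S, Ψ D S) ∂(μ : Measure (QuadConfig (Set.univ : Set ℂ)))))) →
      (∀ D : DobrushinDomain, ∃ E : ℝ → DiscreteDobrushin, ZdDiscretisationFamily D E) →
      ∀ μ ∈ subseqQuadLimits (Set.univ : Set ℂ), ∀ D D' : DobrushinDomain,
        D'.carrier = D.carrier → D'.pt 0 = D.pt 0 → D'.pt 1 = D.pt 1 →
          (μ : Measure (QuadConfig (Set.univ : Set ℂ))).map (Ψ D') =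
            (μ : Measure (QuadConfig (Set.univ : Set ℂ))).map (Ψ D))
    (Ψ : DobrushinDomain → QuadConfig (Set.univ : Set ℂ) → CurveClass ℂ)
    (hΨ1 : ∀ D : DobrushinDomain, Measurable (Ψ D))
    (hΨ3 : ∀ (μ : FiniteMeasure (QuadConfig (Set.univ : Set ℂ))) (δs : ℕ → ℝ), (∀ n, 0 < δs n) →
      Tendsto δs atTop (𝓝 0) →
      Tendsto (fun n => z2QuadLaw (Set.univ : Set ℂ) (δs n)) atTop (𝓝 μ) →
      ∀ (D : DobrushinDomain) (E : ℝ → DiscreteDobrushin), ZdDiscretisationFamily D E →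
        ∀ f : (QuadConfig (Set.univ : Set ℂ) × CurveClass ℂ) →ᵇ ℝ,
          Tendsto (fun n => ∫ ω, f (z2QuadConfig (Set.univ : Set ℂ) (δs n) ω,
              bondInterfaceIn D (E (δs n)) ω) ∂(bondPercolation (zdGraph 2) half))
            atTop (𝓝 (∫ S, f (S, Ψ D S) ∂(μ : Measure (QuadConfig (Set.univ : Set ℂ))))))
    (h5 : ∀ D : DobrushinDomain, ∃ E : ℝ → DiscreteDobrushin, ZdDiscretisationFamily D E)
    (μ : FiniteMeasure (QuadConfig (Set.univ : Set ℂ))) (δs : ℕ → ℝ) (hpos : ∀ n, 0 < δs n)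
    (hlim : Tendsto δs atTop (𝓝 0))
    (hquad : Tendsto (fun n => z2QuadLaw (Set.univ : Set ℂ) (δs n)) atTop (𝓝 μ))
    (D : DobrushinDomain) (E : ℝ → DiscreteDobrushin) (hE : ZdDiscretisationFamily D E)
    (g : CurveClass ℂ →ᵇ ℝ) :
    Tendsto (fun n =>
        (∫ ω, g (bondInterfaceIn D (E (δs n)) ω) ∂(bondPercolation (zdGraph 2) half)) -
          ∫ ω, g (bondInterfaceIn D ⟨(E (δs n)).Ω, (E (δs n)).δ, (E (δs n)).arcB, (E (δs n)).arcA⟩ ω)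
            ∂(bondPercolation (zdGraph 2) half))
      atTop (𝓝 0) := by
  have hΛ : μ ∈ subseqQuadLimits (Set.univ : Set ℂ) :=
    (isSubseqQuadLimit_iff Set.univ μ).mpr ⟨δs, hpos, hlim, hquad⟩
  obtain ⟨D', hc, h0, h1, hA, hB⟩ := exists_orientationReversed D
  exact wiringSwap_sameLimit_of_map_eq Ψ hΨ1 hΨ3 μ δs hpos hlim hquad hc h0 h1 hA hB
    (hcar Ψ hΨ1 hΨ3 h5 μ hΛ D D' hc h0 h1) E hE g

end Summit.CriticalPhenomena.CardyFormulaZ2.Theorems.LagHandOff.Negative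

end
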